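import Summits.BirchSwinnertonDyer.Rank1Residual.P2.PrintCf2GenusPeriodMoverOfRingClass
import Summits.BirchSwinnertonDyer.Rank1Residual.P2.PrintCf2GenusPointMoverRecursion
import Summits.BirchSwinnertonDyer.Rank1Residual.P2.CongruentNumberThetaCriterionCosets
import HarnessLib

/-!
# Crux `PrintCf2.RamifiedOffTYZOfFacts` (stmt-BirchSwinnertonDyer-20509), line `offtyz-v7`, LEAD cycle 8 (cruxlead-20509 g7):
# SQUARES OF GALOIS ELEMENTS AS MOVERS — block by block, and the mod-2 Möbius inversion of the genus-point recursion

Kernel helpers toward the `s = 1` stratum of the residual item 23432 `RamifiedOffJumpOneOfFacts` for `n ≡ 5 (mod 8)`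
(all `--supports stmt-BirchSwinnertonDyer-20509`).  THEOREMS ONLY (no `def`, no named fact, no `sorry`).

WHAT.  For the Tian–Yuan–Zhang genus-point data `D : GenusPointData n` with the printed CM-point layer
(`CMBlockSpec`, `SevenBlockSpec`, `ConjSpec`), and ANY automorphism `g` of `ℍ′_n`:
* §1 `g` maps `i ↦ ±i`, `√−d ↦ ±√−d`; hence the SQUARE `g*g` is trivial on `L_n(i)` (`trivialOnL_mul_self`) and fixes every
  `√−d`, `d ∣ n` — the shape of mover the Galois-mover door (p672160) consumes.
* §2 On a block `d ≡ 5, 6 (mod 8)`: if `g` FLIPS `√−d` then `g*g ∈ Gal(ℍ′_n/H′_d)` (it is `c t c t` for `t = c g` fixing `√−d`,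
  (G5)) and `g*g` FIXES `Z(d)` (`galPt_mul_self_Z_eq_of_apply_sqrtNeg_eq_neg`); if `g` fixes `√−d` and `d ≡ 5 (mod 8)`, THEOREM B
  layer 1 (ty2, `galPt_genusPeriod_dichotomy_of_cmBlockSpec`) applies to `g*g`.  Unified: `g*g·Z(d) = Z(d) + [g(√−d) = √−d ∧
  (g*g)^{g(d)} σ⁻¹ ∈ Gal(ℍ′_n/H′_d)]·τ(1)` (`galPt_mul_self_Z_eq_add_ite`).
* §3 THE MOD-2 MÖBIUS INVERSION of TYZ's recursion `P(e) = Z(e) − Σ_{d₀ ∈ recursionIndex e} ε𝓛(e/d₀)P(d₀)` for ODD square-free `n`: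
  if every block's genus period moves by `m(d)·τ(1)` under an automorphism `G` fixing `i`, then
  `G·P(n) = P(n) + (m(n) + Σ_{d ∈ recursionIndex n} |𝓛(n/d)|·m(d))·τ(1)` (`galPt_P_eq_add_moebius`) — the chains of length `≥ 2`
  cancel in pairs under the fixed-point-free involution `(d, d′) ↦ (d′·n/d, d′)` (`sum_sum_recursionIndex_eq_zero`).
Sequel files assemble §2–§3 with the Rédei side (the `kerSum` of the real Rédei matrix of each block) and g6's identity (★).
BSD is not proved by any of this; no class is closed by this file.

References: [cite: TianYuanZhang2017, §3.1 (p0011 L53–L73), Prop. 3.2 (1), Thm. 3.6 (1) (p0012 L22–L36), proof of Lemma 3.15 (J750),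
proof of Lemma 3.21 (p0020 L50–L63)]; [cite: Cox2013, Lemma 9.3]; crux notes `Lines/offtyz_v7_TransferLayer.md` §3, `Lines/offtyz_v7_QForm.md` §1–§3.
-/

noncomputable section

open scoped Classical

open WeierstrassCurve WeierstrassCurve.Affine Finset Literature.NumberTheory.EllipticCurves
  Literature.NumberTheory.EllipticCurves.TianYuanZhang2017
  Literature.NumberTheory.EllipticCurves.TianYuanZhang2017.W2
  Summit.BirchSwinnertonDyer.Rank1Residual.P2.GenusPeriodTransferLayer
  Summit.BirchSwinnertonDyer.Rank1Residual.P2.ThetaDescent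

set_option autoImplicit false

namespace Summit.BirchSwinnertonDyer.PrintCf2.MoverAssembly

variable {n : ℕ} (D : GenusPointData n)

/-! ## §1 Signs of an automorphism on `i` and `√−d`; squares are trivial on `L_n(i)` -/

/-- In a field, `y² = x²` forces `y = x` or `y = −x`. [folklore] -/
theorem eq_or_eq_neg_of_sq_eq_sq' {F : Type*} [Field F] {x y : F} (h : y ^ 2 = x ^ 2) : y = x ∨ y = -x := by
  have : (y - x) * (y + x) = 0 := by linear_combination h
  rcases mul_eq_zero.mp this with h1 | h1
  · left; linear_combination h1
  · right; linear_combination h1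

/-- An automorphism of `ℍ′_n` maps `i` to `±i`. [cite: TianYuanZhang2017, §3.1 (p0011 L60–L64: i ∈ ℍ′_n)] -/
theorem apply_im_eq_or (g : D.H ≃ₐ[ℚ] D.H) : g D.im = D.im ∨ g D.im = -D.im := by
  apply eq_or_eq_neg_of_sq_eq_sq'
  rw [← map_pow, D.im_sq, map_neg, map_one]

/-- An automorphism of `ℍ′_n` maps `√−d` to `±√−d` (`d ∣ n`). [cite: TianYuanZhang2017, §3.1 (p0011 L60–L64: K_d ⊂ ℍ′_n)] -/
theorem apply_sqrtNeg_eq_or (g : D.H ≃ₐ[ℚ] D.H) {d : ℕ} (hd : d ∈ n.divisors) :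
    g (D.sqrtNeg d) = D.sqrtNeg d ∨ g (D.sqrtNeg d) = -D.sqrtNeg d := by
  apply eq_or_eq_neg_of_sq_eq_sq'
  rw [← map_pow, D.sqrtNeg_sq d hd, map_neg, map_natCast]

/-- The square of an automorphism fixes `i`. [cite: TianYuanZhang2017, §3.1 (p0011 L60–L64)] -/
theorem mul_self_apply_im (g : D.H ≃ₐ[ℚ] D.H) : (g * g) D.im = D.im := by
  rw [AlgEquiv.mul_apply]
  rcases apply_im_eq_or D g with h | h
  · rw [h, h]
  · rw [h, map_neg, h, neg_neg]

/-- The square of an automorphism fixes every `√−d`, `d ∣ n`. [cite: TianYuanZhang2017, §3.1 (p0011 L60–L64)] -/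
theorem mul_self_apply_sqrtNeg (g : D.H ≃ₐ[ℚ] D.H) {d : ℕ} (hd : d ∈ n.divisors) :
    (g * g) (D.sqrtNeg d) = D.sqrtNeg d := by
  rw [AlgEquiv.mul_apply]
  rcases apply_sqrtNeg_eq_or D g hd with h | h
  · rw [h, h]
  · rw [h, map_neg, h, neg_neg]

/-- **The square of ANY automorphism of `ℍ′_n` is trivial on `L_n(i) = ℚ(i, √d : d ∣ n)`.**
[cite: TianYuanZhang2017, proof of Lemma 3.21 (p0020 L55–L58: L_n(i) = ℚ(i, √d : d ∣ n))] -/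
theorem trivialOnL_mul_self (g : D.H ≃ₐ[ℚ] D.H) : D.TrivialOnL n (g * g) :=
  ⟨mul_self_apply_im D g, fun _ hd _ => mul_self_apply_sqrtNeg D g hd⟩

/-- The square of an automorphism is trivial on `L_d(i)` for every `d ∣ n`. [cite: TianYuanZhang2017, proof of Lemma 3.21 (p0020 L55–L58)] -/
theorem trivialOnL_mul_self_of_mem_divisors (g : D.H ≃ₐ[ℚ] D.H) {d : ℕ} (hd : d ∈ n.divisors) :
    D.TrivialOnL d (g * g) :=
  trivialOnL_of_dvd D hd (trivialOnL_mul_self D g)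

/-- The square of an automorphism lies in `Gal(ℍ′_n/K_d)` for every `d`. [cite: TianYuanZhang2017, §3.1 (p0011 L1–L13)] -/
theorem mul_self_mem_galK (g : D.H ≃ₐ[ℚ] D.H) {d : ℕ} (hd : d ∈ n.divisors) : g * g ∈ D.galK d :=
  (D.mem_galK_iff d _).mpr (mul_self_apply_sqrtNeg D g hd)

/-! ## §2 Block motion of `Z(d)` under a square -/

/-- **If `g` flips `√−d` then `g*g ∈ Gal(ℍ′_n/H′_d)`** (block `d ≡ 5, 6 (mod 8)` of the CM-point display, `c` its complex conjugation):
`t := c·g` fixes `√−d`, and `c t c t = g g` since `c² = 1` — (G5) «`c` inverts `Gal(H′_d/K_d)`».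
[cite: TianYuanZhang2017, proof of Lemma 3.15 (J750 = p0015 L106–L110)] [cite: Cox2013, Lemma 9.3] -/
theorem mul_self_mem_of_apply_sqrtNeg_eq_neg {d : ℕ} (hd : d ∈ n.divisors)
    {z : APoint D.H} {Φ : Finset (D.H ≃ₐ[ℚ] D.H)} {ΓH ΓH' : Subgroup (D.H ≃ₐ[ℚ] D.H)} {σ c : D.H ≃ₐ[ℚ] D.H}
    (h : D.CMBlockSpec d z Φ ΓH ΓH' σ c) (hc : D.ConjSpec c) {g : D.H ≃ₐ[ℚ] D.H}
    (hg : g (D.sqrtNeg d) = -D.sqrtNeg d) : g * g ∈ ΓH' := by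
  obtain ⟨-, hcd, hcc⟩ := hc
  have ht : (c * g) (D.sqrtNeg d) = D.sqrtNeg d := by
    rw [AlgEquiv.mul_apply, hg, map_neg, hcd d hd, neg_neg]
  have key := h.2.2.2.2.1.1 (c * g) ht
  have e : c * (c * g) * c * (c * g) = g * g := by
    rw [show c * (c * g) * c * (c * g) = (c * c) * g * (c * c) * g by group, hcc, one_mul, mul_one]
  rwa [e] at key

/-- `Gal(ℍ′_n/H′_d)` fixes the genus period `Z(d) = Σ_{t∈Φ₀} t·z_d` (it is normal and fixes `z_d`).
[cite: TianYuanZhang2017, §3.1 (p0011 L53–L58) and (p0010 L104–L107: H′_n = H_n(z_n))] -/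
theorem galPt_Z_eq_of_mem {d : ℕ}
    {z : APoint D.H} {Φ : Finset (D.H ≃ₐ[ℚ] D.H)} {ΓH ΓH' : Subgroup (D.H ≃ₐ[ℚ] D.H)} {σ c : D.H ≃ₐ[ℚ] D.H}
    (h : D.CMBlockSpec d z Φ ΓH ΓH' σ c) {γ : D.H ≃ₐ[ℚ] D.H} (hγ : γ ∈ ΓH') : D.galPt γ (D.Z d) = D.Z d := by
  obtain ⟨⟨hZ, -⟩, -, ⟨hΓz, hΓn, -⟩, -⟩ := h
  rw [hZ, map_sum]
  refine Finset.sum_congr rfl fun t _ => ?_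
  have hconj : t⁻¹ * γ * t ∈ ΓH' := by
    have := hΓn t⁻¹ γ hγ
    rwa [inv_inv] at this
  calc D.galPt γ (D.galPt t z) = D.galPt t (D.galPt (t⁻¹ * γ * t) z) := by
        rw [← galPt_mul, ← galPt_mul, show t * (t⁻¹ * γ * t) = γ * t by group]
    _ = D.galPt t z := by rw [hΓz _ hconj]

/-- **If `g` flips `√−d` then `g*g` FIXES `Z(d)`** (block `d ≡ 5, 6 (mod 8)`).
[cite: TianYuanZhang2017, proof of Lemma 3.15 (J750) and §3.1 (p0011 L53–L58)] [cite: Cox2013, Lemma 9.3] -/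
theorem galPt_mul_self_Z_eq_of_apply_sqrtNeg_eq_neg {d : ℕ} (hd : d ∈ n.divisors)
    {z : APoint D.H} {Φ : Finset (D.H ≃ₐ[ℚ] D.H)} {ΓH ΓH' : Subgroup (D.H ≃ₐ[ℚ] D.H)} {σ c : D.H ≃ₐ[ℚ] D.H}
    (h : D.CMBlockSpec d z Φ ΓH ΓH' σ c) (hc : D.ConjSpec c) {g : D.H ≃ₐ[ℚ] D.H}
    (hg : g (D.sqrtNeg d) = -D.sqrtNeg d) : D.galPt (g * g) (D.Z d) = D.Z d :=
  galPt_Z_eq_of_mem D h (mul_self_mem_of_apply_sqrtNeg_eq_neg D hd h hc hg)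

/-- **Unified block law for squares** (block `d ≡ 5 (mod 8)`): `g*g·Z(d) = Z(d) + [g(√−d) = √−d ∧ (g*g)^{g(d)}σ⁻¹ ∈ Gal(ℍ′_n/H′_d)]·τ(1)`.
[cite: TianYuanZhang2017, Prop. 3.2 (1), Thm. 3.6 (1) (p0012 L27–L29), proof of Lemma 3.21 (p0020 L55–L62)] -/
theorem galPt_mul_self_Z_eq_add_ite {d : ℕ} (hd : d ∈ n.divisors) (hd8 : d % 8 = 5)
    {z : APoint D.H} {Φ : Finset (D.H ≃ₐ[ℚ] D.H)} {ΓH ΓH' : Subgroup (D.H ≃ₐ[ℚ] D.H)} {σ c : D.H ≃ₐ[ℚ] D.H}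
    (h : D.CMBlockSpec d z Φ ΓH ΓH' σ c) (hc : D.ConjSpec c) (g : D.H ≃ₐ[ℚ] D.H) :
    D.galPt (g * g) (D.Z d) = D.Z d +
      (if g (D.sqrtNeg d) = D.sqrtNeg d ∧ (g * g) ^ gK d * σ⁻¹ ∈ ΓH' then 1 else 0) • (tauOne : APoint D.H) := by
  by_cases hfix : g (D.sqrtNeg d) = D.sqrtNeg d
  · have hL : D.TrivialOnL d (g * g) := trivialOnL_mul_self_of_mem_divisors D g hd
    rcases galPt_genusPeriod_dichotomy_of_cmBlockSpec D hd hd8 h hL with ⟨h1, h2⟩ | ⟨h1, h2⟩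
    · have hσΓ' : σ ∉ ΓH' := (sigma_trivialOnL_and_not_mem_of_cmBlockSpec D hd hd8 h).2.1
      have hnot : ¬ ((g * g) ^ gK d * σ⁻¹ ∈ ΓH') := fun hm => by
        apply hσΓ'
        have := ΓH'.mul_mem (ΓH'.inv_mem hm) h1
        rwa [mul_inv_rev, inv_inv, mul_assoc, inv_mul_cancel, mul_one] at this
      rw [h2, if_neg (fun hh => hnot hh.2), zero_smul, add_zero]
    · rw [h2, if_pos ⟨hfix, h1⟩, one_smul]
  · have hneg : g (D.sqrtNeg d) = -D.sqrtNeg d := (apply_sqrtNeg_eq_or D g hd).resolve_left hfix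
    rw [galPt_mul_self_Z_eq_of_apply_sqrtNeg_eq_neg D hd h hc hneg, if_neg (fun hh => hfix hh.1), zero_smul, add_zero]

/-- On a block `d ≡ 7 (mod 8)` a square never moves `Z(d)`. [cite: TianYuanZhang2017, Prop. 3.2 (3) and proof of Lemma 3.21 (p0020 L62–L63)] -/
theorem galPt_mul_self_Z_eq_of_sevenBlockSpec {d : ℕ} (hd : d ∈ n.divisors) (hd1 : 1 < d) (h7 : D.SevenBlockSpec d)
    (g : D.H ≃ₐ[ℚ] D.H) : D.galPt (g * g) (D.Z d) = D.Z d :=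
  galPt_Z_eq_of_sevenBlockSpec D hd hd1 h7 (trivialOnL_mul_self D g)

/-! ## §3 The mod-2 Möbius inversion of the recursion (odd `n`) -/

/-- Arithmetic of the pair involution `(d, d′) ↦ (d′·(n/d), d′)`: for `d ∣ n`, `d′ ∣ d`, `n ≠ 0`,
`n/(d′·(n/d)) = d/d′`, `(d′·(n/d))/d′ = n/d`, `d′·(n/d) ∣ n` and `d′·(n/d) ≠ 0`. [folklore] -/
theorem div_pair_invol_aux {N d d' : ℕ} (hd : d ∣ N) (hd' : d' ∣ d) (hN : N ≠ 0) :
    N / (d' * (N / d)) = d / d' ∧ d' * (N / d) / d' = N / d ∧ d' * (N / d) ∣ N ∧ d' * (N / d) ≠ 0 := by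
  obtain ⟨q, rfl⟩ := hd
  obtain ⟨r, rfl⟩ := hd'
  have hd'0 : 0 < d' := Nat.pos_of_ne_zero fun h => hN (by rw [h]; ring)
  have hr0 : 0 < r := Nat.pos_of_ne_zero fun h => hN (by rw [h]; ring)
  have hq0 : 0 < q := Nat.pos_of_ne_zero fun h => hN (by rw [h]; ring)
  have e1 : d' * r * q / (d' * r) = q := Nat.mul_div_cancel_left q (by positivity)
  have e2 : d' * r / d' = r := Nat.mul_div_cancel_left r hd'0
  rw [e1, e2]
  refine ⟨?_, Nat.mul_div_cancel_left q hd'0, ⟨r, by ring⟩, by positivity⟩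
  rw [show d' * r * q = (d' * q) * r by ring]
  exact Nat.mul_div_cancel_left r (by positivity)

/-- **The length-two chains of the recursion cancel in pairs (odd square-free `n`).**  For functions `ℓ, μ : ℕ → ZMod 2`,
`Σ_{d ∈ recursionIndex n} Σ_{d′ ∈ recursionIndex d} ℓ(n/d)·ℓ(d/d′)·μ(d′) = 0`: the map `(d, d′) ↦ (d′·(n/d), d′)` is a fixed-point-free
involution of the index set exchanging the two quotients `n/d` and `d/d′` (both `≡ 1, 3 (mod 8)`, `> 1`; for odd `d′ ≡ 5, 7` the products
`d′·(n/d)` are again `≡ 5, 7 (mod 8)`), and it has no fixed point because `d` and `n/d` are coprime. [cite: TianYuanZhang2017, §3.1 (p0011 L67–L73)] -/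
theorem sum_sum_recursionIndex_eq_zero (hn : Squarefree n) (hodd : Odd n) (ℓ μ : ℕ → ZMod 2) :
    ∑ d ∈ recursionIndex n, ∑ d' ∈ recursionIndex d, ℓ (n / d) * ℓ (d / d') * μ d' = 0 := by
  have hn0 : n ≠ 0 := hn.ne_zero
  have hσ : (∑ d ∈ recursionIndex n, ∑ d' ∈ recursionIndex d, ℓ (n / d) * ℓ (d / d') * μ d') =
      ∑ x ∈ (recursionIndex n).sigma (fun d => recursionIndex d), ℓ (n / x.1) * ℓ (x.1 / x.2) * μ x.2 := by
    rw [Finset.sum_sigma]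
  rw [hσ]
  -- unpack membership once
  have hmem : ∀ d d' : ℕ, (⟨d, d'⟩ : Σ _ : ℕ, ℕ) ∈ (recursionIndex n).sigma (fun d => recursionIndex d) →
      d ∣ n ∧ d' ∣ d ∧ (d % 8 = 5 ∨ d % 8 = 6 ∨ d % 8 = 7) ∧
        ((n / d) % 8 = 1 ∨ (n / d) % 8 = 2 ∨ (n / d) % 8 = 3) ∧ 1 < n / d ∧
        (d' % 8 = 5 ∨ d' % 8 = 6 ∨ d' % 8 = 7) ∧
        ((d / d') % 8 = 1 ∨ (d / d') % 8 = 2 ∨ (d / d') % 8 = 3) ∧ 1 < d / d' := by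
    intro d d' hx
    simp only [Finset.mem_sigma] at hx
    obtain ⟨hd, hd'⟩ := hx
    rw [mem_recursionIndex_iff] at hd hd'
    exact ⟨Nat.dvd_of_mem_divisors hd.1, Nat.dvd_of_mem_divisors hd'.1, hd.2.1, hd.2.2.1, hd.2.2.2,
      hd'.2.1, hd'.2.2.1, hd'.2.2.2⟩
  refine Finset.sum_involution (fun x _ => ⟨x.2 * (n / x.1), x.2⟩) ?_ ?_ ?_ ?_
  · -- summands of a pair cancel (they are equal; characteristic 2)
    rintro ⟨d, d'⟩ hx
    obtain ⟨hdd, hd'dd, -, -, -, -, -, -⟩ := hmem d d' hx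
    obtain ⟨e1, e2, -, -⟩ := div_pair_invol_aux hdd hd'dd hn0
    simp only [e1, e2]
    rw [← CharTwo.sub_eq_add, sub_eq_zero]
    ring
  · -- no fixed points
    rintro ⟨d, d'⟩ hx _
    obtain ⟨hdd, hd'dd, -, -, hgt, -, -, -⟩ := hmem d d' hx
    intro heq
    simp only [Sigma.mk.injEq, heq_eq_eq] at heq
    obtain ⟨h1, -⟩ := heq
    -- `d' * (n/d) = d`: then `n/d` divides `d`, but `gcd(d, n/d) = 1` (square-free) and `n/d > 1`
    have hdvd : n / d ∣ d := ⟨d', by rw [mul_comm]; exact h1.symm⟩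
    have hnd : d * (n / d) = n := Nat.mul_div_cancel' hdd
    have hcop : Nat.Coprime d (n / d) := Nat.coprime_of_squarefree_mul (hnd.symm ▸ hn)
    have : n / d = 1 := Nat.eq_one_of_dvd_coprimes hcop.symm (dvd_refl _) hdvd
    omega
  · -- the image stays in the index set
    rintro ⟨d, d'⟩ hx
    obtain ⟨hdd, hd'dd, hd8, hq8, hgt, hd'8, hq'8, hgt'⟩ := hmem d d' hx
    obtain ⟨e1, e2, hdvd, hne⟩ := div_pair_invol_aux hdd hd'dd hn0
    simp only [Finset.mem_sigma]
    rw [mem_recursionIndex_iff, mem_recursionIndex_iff, e1, e2]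
    -- parities: everything is odd
    have hdodd : Odd d := hodd.of_dvd_nat hdd
    have hd'odd : Odd d' := hdodd.of_dvd_nat hd'dd
    have hqodd : Odd (n / d) := hodd.of_dvd_nat (Nat.div_dvd_of_dvd hdd)
    have hd'2 := Nat.odd_iff.mp hd'odd
    have hq2 := Nat.odd_iff.mp hqodd
    have hd'8' : d' % 8 = 5 ∨ d' % 8 = 7 := by rcases hd'8 with h | h | h <;> omega
    have hq8' : (n / d) % 8 = 1 ∨ (n / d) % 8 = 3 := by rcases hq8 with h | h | h <;> omega
    have hprod8 : (d' * (n / d)) % 8 = 5 ∨ (d' * (n / d)) % 8 = 6 ∨ (d' * (n / d)) % 8 = 7 := by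
      rw [Nat.mul_mod]
      rcases hd'8' with h1 | h1 <;> rcases hq8' with h2 | h2 <;> rw [h1, h2] <;> decide
    have hd'pos : 0 < d' := by omega
    exact ⟨⟨Nat.mem_divisors.mpr ⟨hdvd, hn0⟩, hprod8, hq'8, hgt'⟩,
      Nat.mem_divisors.mpr ⟨dvd_mul_right _ _, hne⟩, hd'8, hq8, hgt⟩
  · -- involutive
    rintro ⟨d, d'⟩ hx
    obtain ⟨hdd, hd'dd, -, -, -, -, -, -⟩ := hmem d d' hx
    obtain ⟨e1, -, -, -⟩ := div_pair_invol_aux hdd hd'dd hn0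
    simp only [e1, Nat.mul_div_cancel' hd'dd]

/-- **Möbius inversion mod 2 of the recursion** (odd square-free `n`): if `μ(e) = m(e) + Σ_{d₀ ∈ recursionIndex e} ℓ(e/d₀)·μ(d₀)` in `ZMod 2` for
`e = n` and for every `e ∈ recursionIndex n`, then `μ(n) = m(n) + Σ_{d ∈ recursionIndex n} ℓ(n/d)·m(d)`.
[cite: TianYuanZhang2017, §3.1 (p0011 L67–L73)] -/
theorem moebius_recursion_mod_two (hn : Squarefree n) (hodd : Odd n) (ℓ m μ : ℕ → ZMod 2)
    (hrec : ∀ e, (e = n ∨ e ∈ recursionIndex n) → μ e = m e + ∑ d₀ ∈ recursionIndex e, ℓ (e / d₀) * μ d₀) :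
    μ n = m n + ∑ d ∈ recursionIndex n, ℓ (n / d) * m d := by
  rw [hrec n (Or.inl rfl)]
  congr 1
  have hstep : ∀ d ∈ recursionIndex n, ℓ (n / d) * μ d =
      ℓ (n / d) * m d + ∑ d' ∈ recursionIndex d, ℓ (n / d) * ℓ (d / d') * μ d' := fun d hd => by
    rw [hrec d (Or.inr hd), mul_add, Finset.mul_sum]
    simp only [mul_assoc]
  rw [Finset.sum_congr rfl hstep, Finset.sum_add_distrib, sum_sum_recursionIndex_eq_zero hn hodd ℓ μ, add_zero]

/-- `k·τ(1) = k′·τ(1)` iff `k ≡ k′ (mod 2)`. [cite: TianYuanZhang2017, Lemma 3.16 (p0017 L105–L113: τ(1) of exact order 2)] -/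
theorem nsmul_tauOne_eq_nsmul_tauOne_iff {H : Type} [Field H] [CharZero H] (k k' : ℕ) :
    k • (tauOne : APoint H) = k' • tauOne ↔ (k : ZMod 2) = (k' : ZMod 2) := by
  rw [nsmul_tauOne_eq_mod_two k, nsmul_tauOne_eq_mod_two k', ZMod.natCast_eq_natCast_iff']
  constructor
  · intro h
    by_contra hne
    have hk : k % 2 = 0 ∨ k % 2 = 1 := Nat.mod_two_eq_zero_or_one k
    have hk' : k' % 2 = 0 ∨ k' % 2 = 1 := Nat.mod_two_eq_zero_or_one k'
    rcases hk with hk | hk <;> rcases hk' with hk' | hk' <;> rw [hk, hk'] at h <;> try exact hne (hk.trans hk'.symm)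
    · rw [zero_smul, one_smul] at h; exact tauOne_ne_zero h.symm
    · rw [zero_smul, one_smul] at h; exact tauOne_ne_zero h
  · intro h; rw [h]

/-- The `ZMod 2`-valued multiple of `τ(1)`: `k·τ(1) = (k : ZMod 2).val·τ(1)`. [cite: TianYuanZhang2017, Lemma 3.16 (p0017 L105–L113)] -/
theorem nsmul_tauOne_eq_val_cast {H : Type} [Field H] [CharZero H] (k : ℕ) :
    k • (tauOne : APoint H) = ((k : ZMod 2).val) • tauOne := by
  rw [ZMod.val_natCast, nsmul_tauOne_eq_mod_two]

/-- **`G·P(n) = P(n) + (m(n) + Σ_{d ∈ recursionIndex n} |𝓛(n/d)|·m(d))·τ(1)`** for an automorphism `G` fixing `i` under which every block's genus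
PERIOD `Z(d)` moves by `m(d)·τ(1)` (ODD square-free `n`; the recursion of TYZ §3.1 displayed as `GenusPointData.recursion`): the genus POINT of `n`
moves by the parity of `m(n) + Σ_d 𝓛(n/d) m(d)` — all longer chains of the recursion cancel (`moebius_recursion_mod_two`).
[cite: TianYuanZhang2017, §3.1 (p0011 L67–L73) and proof of Lemma 3.21 (p0020 L27–L63)] -/
theorem galPt_P_eq_add_moebius (hn : Squarefree n) (hodd : Odd n) (h8 : n % 8 = 5 ∨ n % 8 = 6 ∨ n % 8 = 7)
    (hrec : D.recursion) (G : D.H ≃ₐ[ℚ] D.H) (hGi : G D.im = D.im) (m : ℕ → ℕ)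
    (hm : ∀ d ∈ n.divisors, (d % 8 = 5 ∨ d % 8 = 6 ∨ d % 8 = 7) → D.galPt G (D.Z d) = D.Z d + m d • tauOne) :
    D.galPt G (D.P n) = D.P n + (m n + ∑ d ∈ recursionIndex n, (D.scriptL (n / d)).natAbs * m d) • tauOne := by
  have hn0 : n ≠ 0 := hn.ne_zero
  have hnn : n ∈ n.divisors := Nat.mem_divisors_self n hn0
  -- every block's genus point moves by some multiple of `τ(1)`
  have hex := exists_galPt_P_eq_add_nsmul D hrec G hGi (fun d hd hd8 => ⟨m d, hm d hd hd8⟩)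
  choose! μ hμ using hex
  -- the recursion for `μ` modulo 2
  have hμrec : ∀ e ∈ n.divisors, (e % 8 = 5 ∨ e % 8 = 6 ∨ e % 8 = 7) →
      ((μ e : ℕ) : ZMod 2) = (m e : ZMod 2) + ∑ d₀ ∈ recursionIndex e,
        (((D.scriptL (e / d₀)).natAbs : ℕ) : ZMod 2) * ((μ d₀ : ℕ) : ZMod 2) := by
    intro e he he8
    have hlow : ∀ d₀ ∈ recursionIndex e, D.galPt G (D.P d₀) = D.P d₀ + μ d₀ • tauOne := by
      intro d₀ hd₀
      rw [mem_recursionIndex_iff] at hd₀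
      obtain ⟨hd₀e, h8₀, -, -⟩ := hd₀
      exact hμ d₀ (Nat.divisors_subset_of_dvd hn0 (Nat.dvd_of_mem_divisors he) hd₀e) h8₀
    have hS := galPt_recursionSum_eq_add D G hGi e μ hlow
    have hPe := hμ e he he8
    rw [hrec e he he8, map_sub, hm e he he8, hS] at hPe
    -- compare the two expressions for `G·P(e)`
    have key : (m e + ∑ d₀ ∈ recursionIndex e, (D.scriptL (e / d₀)).natAbs * μ d₀) • (tauOne : APoint D.H) =
        μ e • tauOne := by
      have e1 : ∀ (Z S : APoint D.H) (a b : ℕ),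
          Z + a • (tauOne : APoint D.H) - (S + b • tauOne) = Z - S + (a + b) • tauOne := by
        intro Z S a b
        rw [add_smul, show Z + a • (tauOne : APoint D.H) - (S + b • tauOne) = Z - S + (a • tauOne + -(b • tauOne)) by abel,
          neg_nsmul_tauOne]
      rw [e1, ← hrec e he he8] at hPe
      exact add_left_cancel hPe
    rw [nsmul_tauOne_eq_nsmul_tauOne_iff] at key
    rw [← key]
    push_cast
    rfl
  -- Möbius inversion
  have hmob := moebius_recursion_mod_two hn hodd (fun q => (((D.scriptL q).natAbs : ℕ) : ZMod 2))
    (fun d => ((m d : ℕ) : ZMod 2)) (fun d => ((μ d : ℕ) : ZMod 2)) (by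
      intro e he
      rcases he with rfl | he
      · exact hμrec e hnn h8
      · rw [mem_recursionIndex_iff] at he
        exact hμrec e (he.1) he.2.1)
  rw [hμ n hnn h8]
  congr 1
  rw [nsmul_tauOne_eq_nsmul_tauOne_iff, hmob]
  push_cast
  rfl

/-! ## §4 Assembly: the genus point of `n` under a square -/

/-- **`g*g·P(n) = P(n) + (ι(n) + Σ_{d ∈ recursionIndex n} |𝓛(n/d)|·ι(d))·τ(1)`** for ODD square-free `n ≡ 5, 7 (mod 8)` and ANY automorphism
`g` of `ℍ′_n`, where `ι(d) := [d ≡ 5 (mod 8) ∧ g(√−d) = √−d ∧ (g*g)^{g(d)}σ_d⁻¹ ∈ Gal(ℍ′_n/H′_d)]` is the block motion of §2 (blocks `d ≡ 7`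
never move, blocks `d ≡ 6` do not occur).  Hypotheses: the recursion (`GenusPointData.recursion`) and the printed CM-point layer on every block
(`CMBlockSpec` for `d ≡ 5, 6`, `SevenBlockSpec` for `d ≡ 7`, one complex conjugation `ConjSpec c`) — the objects of `CMPointGaloisPrinted` /
`CMPointRingClassPrinted`, unpacked. [cite: TianYuanZhang2017, §3.1 (p0011 L53–L73), Prop. 3.2, Thm. 3.6 (1), proof of Lemma 3.21 (p0020 L27–L63)] -/
theorem galPt_mul_self_P_eq_add (hn : Squarefree n) (h8 : n % 8 = 5 ∨ n % 8 = 7) (hrec : D.recursion)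
    (z : ℕ → APoint D.H) (Φ : ℕ → Finset (D.H ≃ₐ[ℚ] D.H)) (ΓH ΓH' : ℕ → Subgroup (D.H ≃ₐ[ℚ] D.H))
    (σ : ℕ → (D.H ≃ₐ[ℚ] D.H)) (c : D.H ≃ₐ[ℚ] D.H) (hc : D.ConjSpec c)
    (hblock : ∀ d ∈ n.divisors, ((d % 8 = 5 ∨ d % 8 = 6) → D.CMBlockSpec d (z d) (Φ d) (ΓH d) (ΓH' d) (σ d) c) ∧
      (d % 8 = 7 → D.SevenBlockSpec d))
    (g : D.H ≃ₐ[ℚ] D.H) :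
    D.galPt (g * g) (D.P n) = D.P n +
      ((if n % 8 = 5 ∧ g (D.sqrtNeg n) = D.sqrtNeg n ∧ (g * g) ^ gK n * (σ n)⁻¹ ∈ ΓH' n then 1 else 0) +
        ∑ d ∈ recursionIndex n, (D.scriptL (n / d)).natAbs *
          (if d % 8 = 5 ∧ g (D.sqrtNeg d) = D.sqrtNeg d ∧ (g * g) ^ gK d * (σ d)⁻¹ ∈ ΓH' d then 1 else 0)) • tauOne := by
  have hodd : Odd n := Nat.odd_iff.mpr (by rcases h8 with h | h <;> omega)
  have h8' : n % 8 = 5 ∨ n % 8 = 6 ∨ n % 8 = 7 := by rcases h8 with h | h <;> omega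
  refine galPt_P_eq_add_moebius D hn hodd h8' hrec (g * g) (mul_self_apply_im D g)
    (fun d => if d % 8 = 5 ∧ g (D.sqrtNeg d) = D.sqrtNeg d ∧ (g * g) ^ gK d * (σ d)⁻¹ ∈ ΓH' d then 1 else 0) ?_
  intro d hd hd8
  have hdodd : Odd d := hodd.of_dvd_nat (Nat.dvd_of_mem_divisors hd)
  have hd2 := Nat.odd_iff.mp hdodd
  rcases hd8 with h5 | h6 | h7
  · rw [galPt_mul_self_Z_eq_add_ite D hd h5 ((hblock d hd).1 (Or.inl h5)) hc g]
    by_cases hh : g (D.sqrtNeg d) = D.sqrtNeg d ∧ (g * g) ^ gK d * (σ d)⁻¹ ∈ ΓH' d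
    · rw [if_pos hh, if_pos ⟨h5, hh⟩]
    · rw [if_neg hh, if_neg (fun hh' => hh hh'.2)]
  · exfalso; omega
  · have hd1 : 1 < d := by omega
    rw [galPt_mul_self_Z_eq_of_sevenBlockSpec D hd hd1 ((hblock d hd).2 h7) g, if_neg (fun hh => by omega), zero_smul, add_zero]

/-- **Mover criterion for squares**: under the hypotheses of `galPt_mul_self_P_eq_add`, `g*g` MOVES `P(n)` iff
`ι(n) + Σ_{d ∈ recursionIndex n} |𝓛(n/d)|·ι(d)` is ODD. [cite: TianYuanZhang2017, §3.1 (p0011 L53–L73) and proof of Lemma 3.21 (p0020 L27–L63)] -/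
theorem galPt_mul_self_P_ne_iff (hn : Squarefree n) (h8 : n % 8 = 5 ∨ n % 8 = 7) (hrec : D.recursion)
    (z : ℕ → APoint D.H) (Φ : ℕ → Finset (D.H ≃ₐ[ℚ] D.H)) (ΓH ΓH' : ℕ → Subgroup (D.H ≃ₐ[ℚ] D.H))
    (σ : ℕ → (D.H ≃ₐ[ℚ] D.H)) (c : D.H ≃ₐ[ℚ] D.H) (hc : D.ConjSpec c)
    (hblock : ∀ d ∈ n.divisors, ((d % 8 = 5 ∨ d % 8 = 6) → D.CMBlockSpec d (z d) (Φ d) (ΓH d) (ΓH' d) (σ d) c) ∧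
      (d % 8 = 7 → D.SevenBlockSpec d))
    (g : D.H ≃ₐ[ℚ] D.H) :
    D.galPt (g * g) (D.P n) ≠ D.P n ↔
      Odd ((if n % 8 = 5 ∧ g (D.sqrtNeg n) = D.sqrtNeg n ∧ (g * g) ^ gK n * (σ n)⁻¹ ∈ ΓH' n then 1 else 0) +
        ∑ d ∈ recursionIndex n, (D.scriptL (n / d)).natAbs *
          (if d % 8 = 5 ∧ g (D.sqrtNeg d) = D.sqrtNeg d ∧ (g * g) ^ gK d * (σ d)⁻¹ ∈ ΓH' d then 1 else 0)) := by
  rw [galPt_mul_self_P_eq_add D hn h8 hrec z Φ ΓH ΓH' σ c hc hblock g, Ne, add_eq_left, nsmul_tauOne_eq_mod_two]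
  constructor
  · intro h
    rw [Nat.odd_iff]
    by_contra h1
    have h0 : _ % 2 = 0 := (Nat.mod_two_eq_zero_or_one _).resolve_right h1
    exact h (by rw [h0, zero_smul])
  · intro h
    rw [Nat.odd_iff.mp h, one_smul]
    exact tauOne_ne_zero

end Summit.BirchSwinnertonDyer.PrintCf2.MoverAssembly

end
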